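import Summits.NavierStokesRegularity.NavierStokesRegularity.Theorems.FilamentSkeletonRssSkeletonJ1RLiaRefEnvelope

/-!
# Route `FilamentSkeletonRss` · crux `SkeletonJ1R` (stmt-NavierStokesRegularity-23610) · stub F2 `LiaDefectL` — GEOMETRY BRICK (G):
# foot parameter and perpendicular distance of a point of the reference relative to a PARTNER datum line grow linearly

Lead `ns-fsr-lead-23610` (g2), line `streamline_kantorovich_R` (skeleton of record v5).  Helper file `--supports stmt-NavierStokesRegularity-23610`;
route-independent (no `Theses` import).

For the point `y = x_j τ` of the LIA reference (tilt `≤ θ₁ ≤ √θd/4` against `t_j`, within the partner-distance budget) and a partner line `k ≠ j`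
(general position `|⟪t_j, t_k⟫| ≤ 1 − θd`, `0 < θd ≤ 1`), with `V = y − w_k`, foot parameter `s = ⟪V, t_k⟫` and squared distance
`a² = ‖V‖² − s²`:
* `IsLiaReference.abs_foot_le` — `|s| ≤ ‖V‖ ≤ √Γ‖q_j − q_k‖ + |τ|`;
* `IsLiaReference.dist_partner_linear` — `(3√θd/4)|τ| − √Γ‖q_j − q_k‖ ≤ √(a²)` (skew divergence: `‖perp_k t_j‖ ≥ √θd`);
* `IsLiaReference.dist_partner_ge_linear` — combined with the landed uniform bound `a ≥ (ρ/2)√Γ`: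
  `c_a·(√Γ + |τ|) ≤ a` with `c_a = min (ρ/4) (3ρ√θd/(16(‖q_j − q_k‖ + ρ/2)))` (a convex combination of the two bounds).
These feed the partner brick P2 (`IsLiaReference.partnerStrand_sub_le`: its `a`, `s`, and the condition `10θ₁|s| ≤ a`).
HONEST FRAMING: MODEL rung, ∃-side helper lemmas toward stub F2 of a HYPOTHETICAL filament-type blow-up skeleton; F2 and the crux 23610 stay OPEN;
nothing here bears on Navier–Stokes regularity, which is NOT proved. [folklore]
-/

-- `dupNamespace` off: the module name repeats `NavierStokesRegularity` by the tree's `Summits/<S>/<S>/Theorems` layout (same as every sibling file).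
set_option linter.dupNamespace false

noncomputable section

namespace Summit.NavierStokesRegularity.NavierStokesRegularity.Theorems.SkeletonJ1RFrame

open Set Function Filter Real Topology
open Literature.Analysis.FluidPDE
open scoped InnerProductSpace BigOperators

variable {N : ℕ} {Γ Rb ρ θd : ℝ} {p t : Fin N → EuclideanSpace ℝ (Fin 3)} {γ : Fin N → ℝ} {α : ℝ} {s₀ : Fin N → ℝ}
  {x : Fin N → ℝ → EuclideanSpace ℝ (Fin 3)}

/-- **Foot parameter bound**: `|⟪x_j τ − w_k, t_k⟫| ≤ ‖x_j τ − w_k‖ ≤ √Γ‖q_j − q_k‖ + |τ|` (unit speed from the waist). [folklore] -/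
theorem IsLiaReference.abs_foot_le (hx : IsLiaReference Γ Rb p t γ α s₀ x) (ht : ∀ k, ‖t k‖ = 1) (j k : Fin N) (τ : ℝ) :
    |inner ℝ (x j τ - waistPt Γ p t s₀ k) (t k)| ≤ ‖x j τ - waistPt Γ p t s₀ k‖ ∧
      ‖x j τ - waistPt Γ p t s₀ k‖ ≤ Real.sqrt Γ * ‖(p j + s₀ j • t j) - (p k + s₀ k • t k)‖ + |τ| := by
  obtain ⟨hC2, hunit, h0, -, -⟩ := hx j
  refine ⟨by simpa [ht k] using abs_real_inner_le_norm (x j τ - waistPt Γ p t s₀ k) (t k), ?_⟩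
  have hd : Differentiable ℝ (x j) := hC2.differentiable (by norm_num)
  have h := Convex.norm_image_sub_le_of_norm_deriv_le (f := x j) (C := 1) (s := Set.univ) (fun y _ => hd y)
    (fun y _ => (hunit y).le) convex_univ (Set.mem_univ 0) (Set.mem_univ τ)
  rw [one_mul, sub_zero, Real.norm_eq_abs, h0] at h
  have hw : waistPt Γ p t s₀ j - waistPt Γ p t s₀ k = Real.sqrt Γ • ((p j + s₀ j • t j) - (p k + s₀ k • t k)) := by
    rw [waistPt_eq, waistPt_eq, smul_sub]
  calc ‖x j τ - waistPt Γ p t s₀ k‖ = ‖(x j τ - waistPt Γ p t s₀ j) + (waistPt Γ p t s₀ j - waistPt Γ p t s₀ k)‖ := by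
        congr 1; abel
    _ ≤ ‖x j τ - waistPt Γ p t s₀ j‖ + ‖waistPt Γ p t s₀ j - waistPt Γ p t s₀ k‖ := norm_add_le _ _
    _ ≤ |τ| + Real.sqrt Γ * ‖(p j + s₀ j • t j) - (p k + s₀ k • t k)‖ := by
        rw [hw, norm_smul, Real.norm_of_nonneg (Real.sqrt_nonneg Γ)]; linarith
    _ = _ := by ring

/-- The component of a unit vector `t_j` orthogonal to a unit `t_k` with `|⟪t_j,t_k⟫| ≤ 1 − θd` (`0 < θd ≤ 1`) has norm `≥ √θd`. [folklore] -/
theorem norm_perpTo_unit_ge {tj tk : EuclideanSpace ℝ (Fin 3)} (htj : ‖tj‖ = 1) (htk : ‖tk‖ = 1) (hθd : 0 < θd) (hθd1 : θd ≤ 1)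
    (hgp : |inner ℝ tj tk| ≤ 1 - θd) : Real.sqrt θd ≤ ‖tj - (inner ℝ tj tk) • tk‖ := by
  have h := norm_perpTo_sq tk tj htk
  rw [htj, one_pow] at h
  have hc : (inner ℝ tj tk) ^ 2 ≤ (1 - θd) ^ 2 := by
    have := hgp; rw [← sq_abs]; exact pow_le_pow_left₀ (abs_nonneg _) this 2
  have hθ : θd ≤ ‖tj - (inner ℝ tj tk) • tk‖ ^ 2 := by rw [h]; nlinarith
  exact Real.sqrt_le_sqrt hθ |>.trans_eq (Real.sqrt_sq (norm_nonneg _))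

/-- **Linear growth of the partner distance (skew divergence).**  If the reference `x_j` has tilt `≤ θ₁` against `t_j` everywhere, then for the
partner line `k` (`|⟪t_j,t_k⟫| ≤ 1 − θd`, `0 < θd ≤ 1`):
`(√θd − θ₁)|τ| − √Γ‖q_j − q_k‖ ≤ √(‖x_j τ − w_k‖² − ⟪x_j τ − w_k, t_k⟫²)`. [folklore] -/
theorem IsLiaReference.dist_partner_linear (hx : IsLiaReference Γ Rb p t γ α s₀ x) (ht : ∀ k, ‖t k‖ = 1) (hθd : 0 < θd)
    (hθd1 : θd ≤ 1) (j k : Fin N) (hgp : |inner ℝ (t j) (t k)| ≤ 1 - θd) {θ₁ : ℝ}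
    (htilt : ∀ σ, ‖deriv (x j) σ - t j‖ ≤ θ₁) (τ : ℝ) :
    (Real.sqrt θd - θ₁) * |τ| - Real.sqrt Γ * ‖(p j + s₀ j • t j) - (p k + s₀ k • t k)‖ ≤
      Real.sqrt (‖x j τ - waistPt Γ p t s₀ k‖ ^ 2 - (inner ℝ (x j τ - waistPt Γ p t s₀ k) (t k)) ^ 2) := by
  obtain ⟨hC2, hunit, h0, h0', -⟩ := hx j
  set wj := waistPt Γ p t s₀ j with hwj
  set wk := waistPt Γ p t s₀ k with hwk
  set V := x j τ - wk with hV
  set E := x j τ - (wj + τ • t j) with hE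
  -- perpendicular component and its norm
  rw [← norm_perpTo_sq (t k) V (ht k), Real.sqrt_sq (norm_nonneg _)]
  have hEle : ‖E‖ ≤ θ₁ * |τ| := by
    have h := norm_sub_line_le_of_nearStraight (hC2.of_le (by norm_num)) htilt τ
    rw [h0] at h; exact h
  have hdec : V = (wj - wk) + τ • t j + E := by rw [hV, hE]; abel
  -- perp is additive and commutes with scalars; ‖perp v‖ ≤ ‖v‖
  have hP : V - (inner ℝ V (t k)) • t k =
      ((wj - wk) - (inner ℝ (wj - wk) (t k)) • t k) + τ • (t j - (inner ℝ (t j) (t k)) • t k) + (E - (inner ℝ E (t k)) • t k) := by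
    rw [hdec, perpTo_add, perpTo_add, perpTo_smul]
  have h1 : ‖(wj - wk) - (inner ℝ (wj - wk) (t k)) • t k‖ ≤ Real.sqrt Γ * ‖(p j + s₀ j • t j) - (p k + s₀ k • t k)‖ := by
    refine (norm_perpTo_le (t k) _ (ht k)).trans ?_
    rw [hwj, hwk, waistPt_eq, waistPt_eq, ← smul_sub, norm_smul, Real.norm_of_nonneg (Real.sqrt_nonneg Γ)]
  have h2 : Real.sqrt θd * |τ| ≤ ‖τ • (t j - (inner ℝ (t j) (t k)) • t k)‖ := by
    rw [norm_smul, Real.norm_eq_abs, mul_comm]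
    exact mul_le_mul_of_nonneg_left (norm_perpTo_unit_ge (ht j) (ht k) hθd hθd1 hgp) (abs_nonneg τ)
  have h3 : ‖E - (inner ℝ E (t k)) • t k‖ ≤ θ₁ * |τ| := (norm_perpTo_le (t k) E (ht k)).trans hEle
  -- reverse triangle inequality
  rw [hP]
  have hrev : ‖τ • (t j - (inner ℝ (t j) (t k)) • t k)‖ - ‖(wj - wk) - (inner ℝ (wj - wk) (t k)) • t k‖ - ‖E - (inner ℝ E (t k)) • t k‖ ≤
      ‖((wj - wk) - (inner ℝ (wj - wk) (t k)) • t k) + τ • (t j - (inner ℝ (t j) (t k)) • t k) + (E - (inner ℝ E (t k)) • t k)‖ := by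
    have ha := norm_sub_norm_le (τ • (t j - (inner ℝ (t j) (t k)) • t k))
      (-( ((wj - wk) - (inner ℝ (wj - wk) (t k)) • t k) + (E - (inner ℝ E (t k)) • t k)))
    have hb : ‖-(((wj - wk) - (inner ℝ (wj - wk) (t k)) • t k) + (E - (inner ℝ E (t k)) • t k))‖ ≤
        ‖(wj - wk) - (inner ℝ (wj - wk) (t k)) • t k‖ + ‖E - (inner ℝ E (t k)) • t k‖ := by
      rw [norm_neg]; exact norm_add_le _ _
    have hc : τ • (t j - (inner ℝ (t j) (t k)) • t k) - -(((wj - wk) - (inner ℝ (wj - wk) (t k)) • t k) + (E - (inner ℝ E (t k)) • t k)) =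
        ((wj - wk) - (inner ℝ (wj - wk) (t k)) • t k) + τ • (t j - (inner ℝ (t j) (t k)) • t k) + (E - (inner ℝ E (t k)) • t k) := by abel
    rw [hc] at ha
    linarith
  nlinarith

/-- **Uniform linear lower bound for the partner distance.**  With, in addition, the landed uniform bound `(ρ/2)√Γ ≤ a` (`ρ > 0`) and
`θ₁ ≤ √θd/4`: `c_a (√Γ + |τ|) ≤ a` for `c_a = min (ρ/4) (3ρ√θd/(16(‖q_j − q_k‖ + ρ/2)))`. [folklore] -/
theorem dist_partner_ge_linear {a G T D ρ θd θ₁ : ℝ} (hρ : 0 < ρ) (hθd : 0 < θd) (hG : 0 ≤ G) (hT : 0 ≤ T) (hD : 0 ≤ D)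
    (hθ₁ : θ₁ ≤ Real.sqrt θd / 4) (h1 : ρ / 2 * G ≤ a) (h2 : (Real.sqrt θd - θ₁) * T - G * D ≤ a) :
    min (ρ / 4) (3 * ρ * Real.sqrt θd / (16 * (D + ρ / 2))) * (G + T) ≤ a := by
  have hsq : 0 < Real.sqrt θd := Real.sqrt_pos.2 hθd
  have h2' : 3 * Real.sqrt θd / 4 * T - D * G ≤ a := by nlinarith [mul_le_mul_of_nonneg_right hθ₁ hT]
  -- convex combination λ h1 + (1−λ) h2' with λ = (D + ρ/4)/(D + ρ/2)
  have hden : 0 < D + ρ / 2 := by positivity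
  set lam : ℝ := (D + ρ / 4) / (D + ρ / 2) with hlam
  have hlam0 : 0 ≤ lam := by positivity
  have hlam1 : lam ≤ 1 := by rw [hlam, div_le_one hden]; linarith
  have hcomb : lam * (ρ / 2 * G) + (1 - lam) * (3 * Real.sqrt θd / 4 * T - D * G) ≤ a := by
    have := add_le_add (mul_le_mul_of_nonneg_left h1 hlam0) (mul_le_mul_of_nonneg_left h2' (by linarith : 0 ≤ 1 - lam))
    linarith
  -- evaluate the combination: coefficient of G is ρ/4, coefficient of T is (ρ/4)(3√θd/4)/(D + ρ/2)
  have hG_coef : lam * (ρ / 2) - (1 - lam) * D = ρ / 4 := by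
    rw [hlam]; field_simp; ring
  have hT_coef : (1 - lam) * (3 * Real.sqrt θd / 4) = 3 * ρ * Real.sqrt θd / (16 * (D + ρ / 2)) := by
    rw [hlam]; field_simp; ring
  have hval : lam * (ρ / 2 * G) + (1 - lam) * (3 * Real.sqrt θd / 4 * T - D * G) =
      (ρ / 4) * G + (3 * ρ * Real.sqrt θd / (16 * (D + ρ / 2))) * T := by
    rw [← hG_coef, ← hT_coef]; ring
  rw [hval] at hcomb
  have hm1 : min (ρ / 4) (3 * ρ * Real.sqrt θd / (16 * (D + ρ / 2))) * G ≤ (ρ / 4) * G :=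
    mul_le_mul_of_nonneg_right (min_le_left _ _) hG
  have hm2 : min (ρ / 4) (3 * ρ * Real.sqrt θd / (16 * (D + ρ / 2))) * T ≤ (3 * ρ * Real.sqrt θd / (16 * (D + ρ / 2))) * T :=
    mul_le_mul_of_nonneg_right (min_le_right _ _) hT
  nlinarith

end Summit.NavierStokesRegularity.NavierStokesRegularity.Theorems.SkeletonJ1RFrame

end
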